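import Summits.CriticalPhenomena.SAWScalingLimit.Theses.SAWLoopFugacityFlow
import Literature.Probability.RandomPlanarGeometry.SAWScalingLimitFamily
import Summits.CriticalPhenomena.SAWScalingLimit.Theorems.SimpleSubseqLimits.Negative.SimpleSubseqLimitsFalseWithoutEndpointLimits

/-!
# Negative-side results for the crux `SAWLoopFugacityFlow.SimpleSubseqLimits` (stmt-CriticalPhenomena-4982):
INTERIOR ROOTS are in the crux's quantifier, and a typed first lemma of the idea round dies on constants
(work-file §13–§14)

* `exists_isEndpointApprox_interior` — **every Dobrushin domain admits an endpoint approximation whose two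
  lattice endpoints are INTERIOR vertices of `Ω_δ` (all four lattice neighbours present and joined to them)
  for all small `δ > 0`.** The crux (like the summit `SAWScalingLimit`) quantifies over ALL
  `IsEndpointApprox`, so it quantifies over these: after the first step of the walk the slit domain
  `Ω_δ ∖ past` is doubly connected (the past is an island), Kemppainen–Smirnov admissibility (boundary-vertex
  roots, stmt-CriticalPhenomena-11346) fails, and any line fed by a KS-type unforced-crossing bound must carry
  an explicit interior-root reduction (triage finding F2 of TRIAGE-r1-2, here made a checked fact about the
  quantifier). Reversal covers one interior endpoint, never two.
* `not_densePastFutureLemma` — the first lemma of card `slit-continuous-restriction` AS TYPED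
  (`simple_of_dense_pastFuture` in `Cruxes/SimpleSubseqLimits/Ideator3Sketch.lean`: a dense set of times at
  which past and future ranges meet only at the present point ⇒ the class is simple) is FALSE: the constant
  curve satisfies the hypothesis at EVERY time and its class is not simple. Minimal repair: add `γ 0 ≠ γ 1`
  (then fibres are intervals and a light reparametrisation is injective) — the witness misses the repair.

Refuter `cdisprove` (standing adversary, gen 2); the full indexed work file is
`Summits/CriticalPhenomena/SAWScalingLimit/Cruxes/SimpleSubseqLimits/Disproof.lean`.
-/

noncomputable section

open MeasureTheory Filter Topology Set Metric
open Literature.Probability.RandomPlanarGeometry Literature.Probability.RandomPlanarGeometry.SAW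
open Literature.Probability.LatticeModels Literature.Probability.Percolation
open scoped ENNReal NNReal

namespace Summit.CriticalPhenomena.SAWScalingLimit.Theorems.SimpleSubseqLimits.Negative

/-! ## §13 Interior-rooted endpoint approximations exist in every Dobrushin domain -/

section InteriorRoots

/-- Adjacent sites have mesh points at distance `≤ δ` (`δ ≥ 0`). [folklore] -/
theorem dist_meshPoint_le_of_adj {δ : ℝ} (hδ : 0 ≤ δ) {x y : Site 2} (h : (zdGraph 2).Adj x y) :
    dist (meshPoint δ x) (meshPoint δ y) ≤ δ := by
  have key : ∀ (u : Site 2) (i : Fin 2),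
      dist (meshPoint δ u) (meshPoint δ (u + Pi.single i 1)) ≤ δ := by
    intro u i
    rw [Complex.dist_eq]
    have hre : (meshPoint δ u - meshPoint δ (u + Pi.single i 1)).re =
        -(δ * (Pi.single (M := fun _ : Fin 2 => ℤ) i (1 : ℤ) 0 : ℤ)) := by
      simp only [Complex.sub_re, meshPoint_re, Pi.add_apply, Int.cast_add]; ring
    have him : (meshPoint δ u - meshPoint δ (u + Pi.single i 1)).im =
        -(δ * (Pi.single (M := fun _ : Fin 2 => ℤ) i (1 : ℤ) 1 : ℤ)) := by
      simp only [Complex.sub_im, meshPoint_im, Pi.add_apply, Int.cast_add]; ring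
    rw [← Complex.re_add_im (meshPoint δ u - meshPoint δ (u + Pi.single i 1)), hre, him]
    fin_cases i
    · simp [Complex.norm_real, abs_of_nonneg hδ]
    · simp [abs_of_nonneg hδ]
  obtain ⟨i, rfl | rfl⟩ := (zdGraph_adj_iff x y).1 h
  · exact key x i
  · rw [dist_comm]; exact key y i

/-- If the closed disc of radius `2δ` about the mesh point of `x` lies in `Ω` and every site with mesh
point in it lies in `Ω_δ`, then `x` is an INTERIOR VERTEX of `Ω_δ`: each of its four lattice neighbours
is joined to it in `Ω_δ` (so all five sites lie in `meshDomain Ω δ`). [folklore] -/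
theorem isInteriorVertex_of_closedBall {Ω : Set ℂ} {δ : ℝ} (hδ : 0 < δ) {x : Site 2} {z : ℂ} {r : ℝ}
    (hx : dist (meshPoint δ x) z ≤ δ) (hr : 2 * δ ≤ r) (hΩ : closedBall z r ⊆ Ω)
    (hin : ∀ y : Site 2, meshPoint δ y ∈ closedBall z r → y ∈ meshDomain Ω δ) :
    ∀ y : Site 2, (zdGraph 2).Adj x y → (discreteDomainGraph Ω δ).Adj x y := by
  intro y hxy
  have hy : dist (meshPoint δ y) z ≤ 2 * δ :=
    calc dist (meshPoint δ y) z ≤ dist (meshPoint δ y) (meshPoint δ x) + dist (meshPoint δ x) z :=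
          dist_triangle _ _ _
      _ ≤ δ + δ := add_le_add (by rw [dist_comm]; exact dist_meshPoint_le_of_adj hδ.le hxy) hx
      _ = 2 * δ := by ring
  have hxB : meshPoint δ x ∈ closedBall z r := mem_closedBall.2 (hx.trans (by linarith))
  have hyB : meshPoint δ y ∈ closedBall z r := mem_closedBall.2 (hy.trans hr)
  refine discreteDomainGraph_adj_iff.2 ⟨meshGraph_adj_iff.2 ⟨hxy, ?_⟩, hin _ hxB, hin _ hyB⟩
  exact ((convex_closedBall z r).segment_subset hxB hyB).trans (hΩ.trans subset_closure)

/-- **Interior-rooted endpoint approximations exist.** For every Dobrushin domain there are lattice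
endpoints `a δ`, `b δ` forming an `IsEndpointApprox` such that, for all small `δ > 0`, BOTH are interior
vertices of `Ω_δ` (degree four). Construction: as in `SAW.exists_isEndpointApprox` (interior points
`z_n → a`, `w_n → b` with closed discs of radius `r_n` inside `Ω`, bulk lemma
`JordanDomain.exists_forall_mem_meshDomain_and_reachable`, diagonal stage selection), with the stage
threshold sharpened to `2δ ≤ r_n` so that the four neighbours fall into the same disc. [folklore] -/
theorem exists_isEndpointApprox_interior (D : DobrushinDomain) :
    ∃ a b : ℝ → Site 2, IsEndpointApprox D a b ∧
      ∀ᶠ δ in 𝓝[>] (0 : ℝ),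
        (∀ y : Site 2, (zdGraph 2).Adj (a δ) y → (discreteDomainGraph D.carrier δ).Adj (a δ) y) ∧
        (∀ y : Site 2, (zdGraph 2).Adj (b δ) y → (discreteDomainGraph D.carrier δ).Adj (b δ) y) := by
  classical
  have hz : ∀ (i : Fin 2) (n : ℕ), ∃ z ∈ D.carrier, dist z (D.pt i) < 1 / ((n : ℝ) + 1) ∧
      ∃ r > 0, closedBall z r ⊆ D.carrier := by
    intro i n
    obtain ⟨z, hz, hd⟩ := Metric.mem_closure_iff.1
      (frontier_subset_closure (D.pt_mem_frontier i)) (1 / ((n : ℝ) + 1)) (by positivity)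
    obtain ⟨r, hr, hsub⟩ := Metric.isOpen_iff.1 D.isOpen z hz
    exact ⟨z, hz, by rwa [dist_comm], r / 2, by positivity,
      (closedBall_subset_ball (by linarith)).trans hsub⟩
  choose z hzΩ hzd r hr hrΩ using hz
  set K : ℕ → Set ℂ := fun n => closedBall (z 0 n) (r 0 n) ∪ closedBall (z 1 n) (r 1 n)
    with hK_def
  have hKc : ∀ n, IsCompact (K n) := fun n =>
    (isCompact_closedBall _ _).union (isCompact_closedBall _ _)
  have hKΩ : ∀ n, K n ⊆ D.carrier := fun n => union_subset (hrΩ 0 n) (hrΩ 1 n)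
  have hstage := fun n =>
    D.toJordanDomain.exists_forall_mem_meshDomain_and_reachable (hKc n) (hKΩ n)
  choose δ₀ hδ₀ hgood using hstage
  obtain ⟨N, hN, hNtop⟩ := exists_stage_tendsto_atTop
    (p := fun n δ => 0 < δ ∧ δ < min (δ₀ n) (min (r 0 n / 2) (r 1 n / 2)))
    (ε := fun n => min (δ₀ n) (min (r 0 n / 2) (r 1 n / 2)))
    (fun n => lt_min (hδ₀ n) (lt_min (half_pos (hr 0 n)) (half_pos (hr 1 n))))
    (fun n δ h₁ h₂ => ⟨h₁, h₂⟩)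
  have hmem : ∀ (i : Fin 2) (δ : ℝ), 0 < δ → δ < r i (N δ) / 2 →
      meshPoint δ (nearestSite δ (z i (N δ))) ∈ closedBall (z i (N δ)) (r i (N δ)) :=
    fun i δ hδ hri => mem_closedBall.2 ((dist_meshPoint_nearestSite_le hδ _).trans (by linarith))
  refine ⟨fun δ => nearestSite δ (z 0 (N δ)), fun δ => nearestSite δ (z 1 (N δ)), ⟨?_,
    tendsto_meshPoint_nearestSite_of_tendsto (hzd 0) hNtop,
    tendsto_meshPoint_nearestSite_of_tendsto (hzd 1) hNtop⟩, ?_⟩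
  · filter_upwards [hN] with δ ⟨hδ, hlt⟩
    have hδ₀' : δ < δ₀ (N δ) := hlt.trans_le (min_le_left _ _)
    have hr0 : δ < r 0 (N δ) / 2 := hlt.trans_le ((min_le_right _ _).trans (min_le_left _ _))
    have hr1 : δ < r 1 (N δ) / 2 := hlt.trans_le ((min_le_right _ _).trans (min_le_right _ _))
    obtain ⟨hin, hconn⟩ := hgood (N δ) δ hδ hδ₀'
    have ha := hin _ (Or.inl (hmem 0 δ hδ hr0))
    have hb := hin _ (Or.inr (hmem 1 δ hδ hr1))
    obtain ⟨_, _, ⟨q⟩⟩ := hconn _ ha _ hb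
    exact reachable_discreteDomainGraph_of_walk q ha
  · filter_upwards [hN] with δ ⟨hδ, hlt⟩
    have hδ₀' : δ < δ₀ (N δ) := hlt.trans_le (min_le_left _ _)
    have hr0 : δ < r 0 (N δ) / 2 := hlt.trans_le ((min_le_right _ _).trans (min_le_left _ _))
    have hr1 : δ < r 1 (N δ) / 2 := hlt.trans_le ((min_le_right _ _).trans (min_le_right _ _))
    obtain ⟨hin, -⟩ := hgood (N δ) δ hδ hδ₀'
    constructor
    · exact isInteriorVertex_of_closedBall hδ (dist_meshPoint_nearestSite_le hδ _) (by linarith)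
        (hrΩ 0 (N δ)) fun y hy => hin y (Or.inl hy)
    · exact isInteriorVertex_of_closedBall hδ (dist_meshPoint_nearestSite_le hδ _) (by linarith)
        (hrΩ 1 (N δ)) fun y hy => hin y (Or.inr hy)

/-- Consequently the crux is NOT weakened by restricting to approximations with boundary-vertex roots:
it must ALSO cover interior-rooted ones, for which (along the sequence) the laws are honest probability
measures on walks whose first step already leaves an island past. Stated as the existence, in every
Dobrushin domain, of an endpoint approximation all of whose small-mesh roots have degree four. [folklore] -/
theorem exists_isEndpointApprox_forall_degree_four (D : DobrushinDomain) :
    ∃ a b : ℝ → Site 2, IsEndpointApprox D a b ∧ ∀ᶠ δ in 𝓝[>] (0 : ℝ),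
      ∀ y : Site 2, (zdGraph 2).Adj (a δ) y → y ∈ meshDomain D.carrier δ ∧ (a δ) ∈ meshDomain D.carrier δ := by
  obtain ⟨a, b, hab, hev⟩ := exists_isEndpointApprox_interior D
  refine ⟨a, b, hab, hev.mono fun δ hδ y hy => ?_⟩
  have h := discreteDomainGraph_adj_iff.1 (hδ.1 y hy)
  exact ⟨h.2.2, h.2.1⟩

end InteriorRoots

/-! ## §14 Pre-kill: the typed first lemma `simple_of_dense_pastFuture` dies on constant curves -/

section DensePastFuture

/-- For a constant curve, past and future ranges are the singleton at every time. [folklore] -/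
theorem const_image_inter (p : ℂ) (t : unitInterval) :
    (Curve.const p) '' Set.Ici t ∩ (Curve.const p) '' Set.Iic t = {(Curve.const p) t} := by
  have h1 : (Curve.const p) '' Set.Ici t = {p} := by
    ext w
    simp only [mem_image, mem_Ici, Curve.const_apply, mem_singleton_iff]
    exact ⟨fun ⟨_, _, h⟩ => h.symm, fun h => ⟨t, le_rfl, h.symm⟩⟩
  have h2 : (Curve.const p) '' Set.Iic t = {p} := by
    ext w
    simp only [mem_image, mem_Iic, Curve.const_apply, mem_singleton_iff]
    exact ⟨fun ⟨_, _, h⟩ => h.symm, fun h => ⟨t, le_rfl, h.symm⟩⟩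
  rw [h1, h2, inter_self, Curve.const_apply]

/-- **`simple_of_dense_pastFuture` is FALSE as typed** (the first lemma of card
`slit-continuous-restriction` in `Cruxes/SimpleSubseqLimits/Ideator3Sketch.lean`, restated verbatim: a dense
set of times at which the future range meets the past range only at the present point would force the class
to be simple): the constant curve at `0` with `T = univ`
satisfies every hypothesis, and its class is not simple (`mk_const_not_mem_simple`). Minimal repair
`C′`: add the hypothesis `γ 0 ≠ γ 1` (in the line's use `a ≠ b`); the witness misses `C′`. [folklore] -/
theorem not_densePastFutureLemma :
    ¬ ∀ (γ : Curve ℂ) (T : Set unitInterval), Dense T →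
        (∀ t ∈ T, γ '' Set.Ici t ∩ γ '' Set.Iic t = {γ t}) → CurveClass.mk γ ∈ CurveClass.simple :=
  fun h => mk_const_not_mem_simple 0
    (h (Curve.const 0) univ dense_univ fun t _ => const_image_inter 0 t)

end DensePastFuture

end Summit.CriticalPhenomena.SAWScalingLimit.Theorems.SimpleSubseqLimits.Negative
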